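import Mathlib
import Literature.Analysis.PDE.Wave1DFarEnergyLimits
import Literature.Analysis.PDE.Wave1DEnergySeminorm
import Literature.Analysis.Calculus.TwoVariablePartials

/-!
# The space of finite-energy far solutions of `ψ_tt − ψ_xx + Wψ = 0` on `{x ≥ 1}` and its channel energies

Analysis/PDE support file (everything proved, no definitions). Toolkit for the class of global `C²`
functions `ψ` whose residual `ψ_tt − ψ_xx + Wψ` vanishes on `{x ≥ 1}` and whose `W`-energy on
`(1,∞)` at `t = 0` is finite ("far solutions"; `W ≥ 0` continuous). It is a real vector space
(`farSol_add`, `farSol_smul`; residuals are additive), the far energies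
`E(t) = ∫_{x>1+|t|} (ψ_t² + ψ_x² + Wψ²)` are finite and converge as `t → ±∞`
(`farSol_energy`, from `Wave1DFarEnergyLimits.lean` with the residual as source), `√E(t)` is
subadditive and `E` scales quadratically (`sqrt_farEnergy_add_le`, `farEnergy_smul`), hence the
NON-RADIATING far solutions (`E(t) → 0` at `±∞`) form a subspace and subtracting one of them does not
increase the channel limits (`farLimit_sub_nonradiating_le`). This is the functional setting of the
kernel-absorption step of the far-side channel estimate of `FixedModeChannels` (route
PhotonSphereChannels, stmt-FinalStateConjecture-10048). Folklore.
-/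

noncomputable section

namespace Literature.Analysis.PDE

open Set Filter MeasureTheory Literature.Analysis.Calculus
open scoped _root_.Topology

variable {W : ℝ → ℝ} {ψ ψ₁ ψ₂ : ℝ → ℝ → ℝ}

/-! ### Residuals are linear -/

/-- The residual of a sum of `C²` functions. [folklore] -/
theorem wave1D_residual_add (hψ₁ : ContDiff ℝ 2 (Function.uncurry ψ₁))
    (hψ₂ : ContDiff ℝ 2 (Function.uncurry ψ₂)) (t x : ℝ) :
    iteratedDeriv 2 (fun τ => ψ₁ τ x + ψ₂ τ x) t - iteratedDeriv 2 (fun y => ψ₁ t y + ψ₂ t y) x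
        + W x * (ψ₁ t x + ψ₂ t x)
      = (iteratedDeriv 2 (fun τ => ψ₁ τ x) t - iteratedDeriv 2 (ψ₁ t) x + W x * ψ₁ t x)
        + (iteratedDeriv 2 (fun τ => ψ₂ τ x) t - iteratedDeriv 2 (ψ₂ t) x + W x * ψ₂ t x) := by
  have c1 : ContDiff ℝ 2 fun τ => ψ₁ τ x := hψ₁.comp (contDiff_id.prodMk contDiff_const)
  have c2 : ContDiff ℝ 2 fun τ => ψ₂ τ x := hψ₂.comp (contDiff_id.prodMk contDiff_const)
  have c3 : ContDiff ℝ 2 (ψ₁ t) := hψ₁.comp (contDiff_const.prodMk contDiff_id)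
  have c4 : ContDiff ℝ 2 (ψ₂ t) := hψ₂.comp (contDiff_const.prodMk contDiff_id)
  rw [iteratedDeriv_fun_add (n := 2) c1.contDiffAt c2.contDiffAt,
    iteratedDeriv_fun_add (n := 2) c3.contDiffAt c4.contDiffAt]
  ring

/-- The residual of a scalar multiple. [folklore] -/
theorem wave1D_residual_smul (c t x : ℝ) :
    iteratedDeriv 2 (fun τ => c * ψ τ x) t - iteratedDeriv 2 (fun y => c * ψ t y) x
        + W x * (c * ψ t x)
      = c * (iteratedDeriv 2 (fun τ => ψ τ x) t - iteratedDeriv 2 (ψ t) x + W x * ψ t x) := by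
  rw [iteratedDeriv_const_mul_field, iteratedDeriv_const_mul_field]
  ring

/-! ### Far solutions: the energy toolkit -/

section FarSol

variable (hW : Continuous W) (hW0 : ∀ x, 0 ≤ W x) (hψ : ContDiff ℝ 2 (Function.uncurry ψ))
  (hres : ∀ t x, 1 ≤ x →
    iteratedDeriv 2 (fun τ => ψ τ x) t - iteratedDeriv 2 (ψ t) x + W x * ψ t x = 0)
  (hint : IntegrableOn (fun x => deriv (fun τ => ψ τ x) 0 ^ 2 + deriv (ψ 0) x ^ 2
    + W x * ψ 0 x ^ 2) (Ioi 1))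
include hW hW0 hψ hres hint

/-- **Far energies of a far solution**: finite lower integral at `t = 0`, integrability on every
`Ioi (1+|t|)`, conversion, and convergence to the `limUnder`s at `±∞` (which are `≥ 0`).
[folklore] -/
theorem farSol_energy :
    (∫⁻ x in Ioi 1, ENNReal.ofReal (deriv (fun τ => ψ τ x) 0 ^ 2 + deriv (ψ 0) x ^ 2
        + W x * ψ 0 x ^ 2) < ⊤) ∧
    (∀ t, IntegrableOn (fun x => deriv (fun τ => ψ τ x) t ^ 2 + deriv (ψ t) x ^ 2
        + W x * ψ t x ^ 2) (Ioi (1 + |t|)) ∧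
      ENNReal.ofReal (∫ x in Ioi (1 + |t|), (deriv (fun τ => ψ τ x) t ^ 2 + deriv (ψ t) x ^ 2
        + W x * ψ t x ^ 2)) = ∫⁻ x in Ioi (1 + |t|), ENNReal.ofReal (deriv (fun τ => ψ τ x) t ^ 2
        + deriv (ψ t) x ^ 2 + W x * ψ t x ^ 2)) ∧
    Tendsto (fun t => ∫ x in Ioi (1 + |t|), (deriv (fun τ => ψ τ x) t ^ 2 + deriv (ψ t) x ^ 2
        + W x * ψ t x ^ 2)) atTop (𝓝 (limUnder atTop fun t => ∫ x in Ioi (1 + |t|),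
          (deriv (fun τ => ψ τ x) t ^ 2 + deriv (ψ t) x ^ 2 + W x * ψ t x ^ 2))) ∧
    Tendsto (fun t => ∫ x in Ioi (1 + |t|), (deriv (fun τ => ψ τ x) t ^ 2 + deriv (ψ t) x ^ 2
        + W x * ψ t x ^ 2)) atBot (𝓝 (limUnder atBot fun t => ∫ x in Ioi (1 + |t|),
          (deriv (fun τ => ψ τ x) t ^ 2 + deriv (ψ t) x ^ 2 + W x * ψ t x ^ 2))) ∧
    0 ≤ limUnder atTop (fun t => ∫ x in Ioi (1 + |t|),
          (deriv (fun τ => ψ τ x) t ^ 2 + deriv (ψ t) x ^ 2 + W x * ψ t x ^ 2)) ∧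
    0 ≤ limUnder atBot (fun t => ∫ x in Ioi (1 + |t|),
          (deriv (fun τ => ψ τ x) t ^ 2 + deriv (ψ t) x ^ 2 + W x * ψ t x ^ 2)) := by
  set F : ℝ → ℝ → ℝ := fun t x =>
    iteratedDeriv 2 (fun τ => ψ τ x) t - iteratedDeriv 2 (ψ t) x + W x * ψ t x with hF
  have hFc : Continuous (Function.uncurry F) := by
    obtain ⟨-, -, φtt, -, φxx, -, -, hctt, -, hcxx, -, -, -, -, -, -, h7, h8⟩ :=
      exists_partials_of_contDiff_two hψ
    have : Function.uncurry F = fun p : ℝ × ℝ => φtt p.1 p.2 - φxx p.1 p.2 + W p.2 * ψ p.1 p.2 := by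
      funext p; simp only [hF, Function.uncurry, h7, h8]
    rw [this]
    exact (hctt.sub hcxx).add ((hW.comp continuous_snd).mul hψ.continuous)
  have hsol : ∀ t x, iteratedDeriv 2 (fun τ => ψ τ x) t - iteratedDeriv 2 (ψ t) x + W x * ψ t x
      = F t x := fun t x => rfl
  have hF0 : ∀ τ x, (1 : ℝ) ≤ x → F τ x = 0 := fun τ x hx => hres τ x hx
  have hfin : (∫⁻ x in Ioi 1, ENNReal.ofReal (deriv (fun τ => ψ τ x) 0 ^ 2 + deriv (ψ 0) x ^ 2
      + W x * ψ 0 x ^ 2)) < ⊤ := by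
    rw [← ofReal_integral_eq_lintegral_ofReal hint
      (ae_of_all _ fun x => wave1D_energyDensity_nonneg hW0 0 x)]
    exact ENNReal.ofReal_lt_top
  obtain ⟨Lp, Lm, hLp0, hLm0, -, -, hTp, hTm⟩ :=
    wave1D_exists_farEnergy_limits hW hW0 hFc hψ hsol (c := 1) hF0 hfin
  refine ⟨hfin, fun t => wave1D_farEnergy_integrableOn hW hW0 hFc hψ hsol (c := 1) hF0 hfin t,
    ?_, ?_, ?_, ?_⟩
  · rw [hTp.limUnder_eq]; exact hTp
  · rw [hTm.limUnder_eq]; exact hTm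
  · rw [hTp.limUnder_eq]; exact hLp0
  · rw [hTm.limUnder_eq]; exact hLm0

end FarSol

/-! ### The vector-space structure -/

/-- **Sums of far solutions are far solutions** (residual and finite energy). [folklore] -/
theorem farSol_add (hW : Continuous W) (hW0 : ∀ x, 0 ≤ W x)
    (hψ₁ : ContDiff ℝ 2 (Function.uncurry ψ₁))
    (hres₁ : ∀ t x, 1 ≤ x →
      iteratedDeriv 2 (fun τ => ψ₁ τ x) t - iteratedDeriv 2 (ψ₁ t) x + W x * ψ₁ t x = 0)
    (hint₁ : IntegrableOn (fun x => deriv (fun τ => ψ₁ τ x) 0 ^ 2 + deriv (ψ₁ 0) x ^ 2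
      + W x * ψ₁ 0 x ^ 2) (Ioi 1))
    (hψ₂ : ContDiff ℝ 2 (Function.uncurry ψ₂))
    (hres₂ : ∀ t x, 1 ≤ x →
      iteratedDeriv 2 (fun τ => ψ₂ τ x) t - iteratedDeriv 2 (ψ₂ t) x + W x * ψ₂ t x = 0)
    (hint₂ : IntegrableOn (fun x => deriv (fun τ => ψ₂ τ x) 0 ^ 2 + deriv (ψ₂ 0) x ^ 2
      + W x * ψ₂ 0 x ^ 2) (Ioi 1)) :
    ContDiff ℝ 2 (Function.uncurry fun t x => ψ₁ t x + ψ₂ t x) ∧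
    (∀ t x, 1 ≤ x → iteratedDeriv 2 (fun τ => ψ₁ τ x + ψ₂ τ x) t
      - iteratedDeriv 2 (fun y => ψ₁ t y + ψ₂ t y) x + W x * (ψ₁ t x + ψ₂ t x) = 0) ∧
    IntegrableOn (fun x => deriv (fun τ => ψ₁ τ x + ψ₂ τ x) 0 ^ 2
      + deriv (fun y => ψ₁ 0 y + ψ₂ 0 y) x ^ 2 + W x * (ψ₁ 0 x + ψ₂ 0 x) ^ 2) (Ioi 1) := by
  refine ⟨hψ₁.add hψ₂, fun t x hx => ?_, ?_⟩
  · rw [wave1D_residual_add hψ₁ hψ₂, hres₁ t x hx, hres₂ t x hx, add_zero]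
  · -- domination by `2 e₁ + 2 e₂`
    have hC : ContDiff ℝ 2 (Function.uncurry fun t x => ψ₁ t x + ψ₂ t x) := hψ₁.add hψ₂
    have hc : Continuous fun x => deriv (fun τ => ψ₁ τ x + ψ₂ τ x) 0 ^ 2
        + deriv (fun y => ψ₁ 0 y + ψ₂ 0 y) x ^ 2 + W x * (ψ₁ 0 x + ψ₂ 0 x) ^ 2 :=
      (continuous_wave1D_energyDensity hW hC).comp (continuous_const.prodMk continuous_id)
    refine Integrable.mono' ((hint₁.const_mul 2).add (hint₂.const_mul 2)) hc.aestronglyMeasurable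
      (ae_of_all _ fun x => ?_)
    have d1 : DifferentiableAt ℝ (fun τ => ψ₁ τ x) 0 :=
      ((hψ₁.comp (contDiff_id.prodMk contDiff_const)).differentiable (by norm_num)) 0
    have d2 : DifferentiableAt ℝ (fun τ => ψ₂ τ x) 0 :=
      ((hψ₂.comp (contDiff_id.prodMk contDiff_const)).differentiable (by norm_num)) 0
    have d3 : DifferentiableAt ℝ (ψ₁ 0) x :=
      ((hψ₁.comp (contDiff_const.prodMk contDiff_id)).differentiable (by norm_num)) x
    have d4 : DifferentiableAt ℝ (ψ₂ 0) x :=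
      ((hψ₂.comp (contDiff_const.prodMk contDiff_id)).differentiable (by norm_num)) x
    rw [Real.norm_eq_abs, abs_of_nonneg (wave1D_energyDensity_nonneg (ψ := fun t x => ψ₁ t x + ψ₂ t x)
      hW0 0 x), deriv_fun_add d1 d2, show (fun y => ψ₁ 0 y + ψ₂ 0 y) = fun y => ψ₁ 0 y + ψ₂ 0 y
      from rfl, deriv_fun_add d3 d4]
    simp only [Pi.add_apply]
    have hWx := hW0 x
    nlinarith [sq_nonneg (deriv (fun τ => ψ₁ τ x) 0 - deriv (fun τ => ψ₂ τ x) 0),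
      sq_nonneg (deriv (ψ₁ 0) x - deriv (ψ₂ 0) x),
      mul_nonneg hWx (sq_nonneg (ψ₁ 0 x - ψ₂ 0 x))]

/-- **Scalar multiples of far solutions are far solutions.** [folklore] -/
theorem farSol_smul (hψ : ContDiff ℝ 2 (Function.uncurry ψ))
    (hres : ∀ t x, 1 ≤ x →
      iteratedDeriv 2 (fun τ => ψ τ x) t - iteratedDeriv 2 (ψ t) x + W x * ψ t x = 0)
    (hint : IntegrableOn (fun x => deriv (fun τ => ψ τ x) 0 ^ 2 + deriv (ψ 0) x ^ 2
      + W x * ψ 0 x ^ 2) (Ioi 1)) (c : ℝ) :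
    ContDiff ℝ 2 (Function.uncurry fun t x => c * ψ t x) ∧
    (∀ t x, 1 ≤ x → iteratedDeriv 2 (fun τ => c * ψ τ x) t
      - iteratedDeriv 2 (fun y => c * ψ t y) x + W x * (c * ψ t x) = 0) ∧
    IntegrableOn (fun x => deriv (fun τ => c * ψ τ x) 0 ^ 2
      + deriv (fun y => c * ψ 0 y) x ^ 2 + W x * (c * ψ 0 x) ^ 2) (Ioi 1) := by
  refine ⟨contDiff_const.mul hψ, fun t x hx => ?_, ?_⟩
  · rw [wave1D_residual_smul, hres t x hx, mul_zero]
  · have : (fun x => deriv (fun τ => c * ψ τ x) 0 ^ 2 + deriv (fun y => c * ψ 0 y) x ^ 2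
        + W x * (c * ψ 0 x) ^ 2) = fun x => c ^ 2 * (deriv (fun τ => ψ τ x) 0 ^ 2
          + deriv (ψ 0) x ^ 2 + W x * ψ 0 x ^ 2) := by
      funext x
      rw [deriv_const_mul_field, show (fun y => c * ψ 0 y) = fun y => c * ψ 0 y from rfl,
        deriv_const_mul_field]
      ring
    rw [this]
    exact hint.const_mul _

/-- **Far energies scale quadratically.** [folklore] -/
theorem farEnergy_smul (c t : ℝ) :
    (∫ x in Ioi (1 + |t|), (deriv (fun τ => c * ψ τ x) t ^ 2 + deriv (fun y => c * ψ t y) x ^ 2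
        + W x * (c * ψ t x) ^ 2))
      = c ^ 2 * ∫ x in Ioi (1 + |t|), (deriv (fun τ => ψ τ x) t ^ 2 + deriv (ψ t) x ^ 2
        + W x * ψ t x ^ 2) := by
  rw [← MeasureTheory.integral_const_mul]
  refine setIntegral_congr_fun measurableSet_Ioi fun x _ => ?_
  rw [deriv_const_mul_field, show (fun y => c * ψ t y) = fun y => c * ψ t y from rfl,
    deriv_const_mul_field]
  ring

/-- **The three pieces of an integrable energy density are integrable**, and the time derivative
slice is continuous (`ψ ∈ C²`). [folklore] -/
theorem farEnergy_pieces (hW : Continuous W) (hW0 : ∀ x, 0 ≤ W x)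
    (hψ : ContDiff ℝ 2 (Function.uncurry ψ)) (t : ℝ) {S : Set ℝ}
    (hi : IntegrableOn (fun x => deriv (fun τ => ψ τ x) t ^ 2 + deriv (ψ t) x ^ 2
      + W x * ψ t x ^ 2) S) :
    Continuous (fun x => deriv (fun τ => ψ τ x) t) ∧
    ContDiff ℝ 1 (fun x => deriv (fun τ => ψ τ x) t) ∧
    IntegrableOn (fun x => deriv (ψ t) x ^ 2) S ∧
    IntegrableOn (fun x => W x * ψ t x ^ 2) S ∧
    IntegrableOn (fun x => deriv (fun τ => ψ τ x) t ^ 2) S := by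
  obtain ⟨φt, -, -, φtx, -, hct, -, -, hctx, -, hd, -, -, -, hdtx, -, -, -⟩ :=
    exists_partials_of_contDiff_two hψ
  have hg : (fun x => deriv (fun τ => ψ τ x) t) = fun x => φt t x := funext fun x => (hd t x).deriv
  have hgc : Continuous fun x => deriv (fun τ => ψ τ x) t := by
    rw [hg]; exact hct.comp (continuous_const.prodMk continuous_id)
  have hg1 : ContDiff ℝ 1 (fun x => deriv (fun τ => ψ τ x) t) := by
    rw [hg, show (1 : WithTop ℕ∞) = 0 + 1 by norm_num, contDiff_succ_iff_deriv]
    refine ⟨fun x => (hdtx t x).differentiableAt, fun h => absurd h (by simp), ?_⟩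
    have : deriv (fun x => φt t x) = fun x => φtx t x := funext fun x => (hdtx t x).deriv
    rw [this]
    exact contDiff_zero.2 (hctx.comp (continuous_const.prodMk continuous_id))
  have hhc : Continuous (deriv (ψ t)) :=
    (hψ.comp (contDiff_const.prodMk contDiff_id)).continuous_deriv (by norm_num)
  have hsl : Continuous (ψ t) := (hψ.comp (contDiff_const.prodMk contDiff_id)).continuous
  refine ⟨hgc, hg1, ?_, ?_, ?_⟩
  · refine Integrable.mono' hi ((hhc.pow 2).aestronglyMeasurable) (ae_of_all _ fun x => ?_)
    rw [Real.norm_eq_abs, abs_of_nonneg (sq_nonneg _)]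
    have := hW0 x
    nlinarith [sq_nonneg (deriv (fun τ => ψ τ x) t), mul_nonneg this (sq_nonneg (ψ t x))]
  · refine Integrable.mono' hi ((hW.mul (hsl.pow 2)).aestronglyMeasurable) (ae_of_all _ fun x => ?_)
    rw [Real.norm_eq_abs, abs_of_nonneg (mul_nonneg (hW0 x) (sq_nonneg _))]
    nlinarith [sq_nonneg (deriv (fun τ => ψ τ x) t), sq_nonneg (deriv (ψ t) x)]
  · refine Integrable.mono' hi ((hgc.pow 2).aestronglyMeasurable) (ae_of_all _ fun x => ?_)
    rw [Real.norm_eq_abs, abs_of_nonneg (sq_nonneg _)]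
    have := hW0 x
    nlinarith [sq_nonneg (deriv (ψ t) x), mul_nonneg this (sq_nonneg (ψ t x))]

/-- **`√E(t)` is subadditive on far solutions** (indeed on `C²` functions with integrable energy
densities on `Ioi (1+|t|)`). [folklore] -/
theorem sqrt_farEnergy_add_le (hW : Continuous W) (hW0 : ∀ x, 0 ≤ W x)
    (hψ₁ : ContDiff ℝ 2 (Function.uncurry ψ₁)) (hψ₂ : ContDiff ℝ 2 (Function.uncurry ψ₂)) (t : ℝ)
    (hi₁ : IntegrableOn (fun x => deriv (fun τ => ψ₁ τ x) t ^ 2 + deriv (ψ₁ t) x ^ 2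
      + W x * ψ₁ t x ^ 2) (Ioi (1 + |t|)))
    (hi₂ : IntegrableOn (fun x => deriv (fun τ => ψ₂ τ x) t ^ 2 + deriv (ψ₂ t) x ^ 2
      + W x * ψ₂ t x ^ 2) (Ioi (1 + |t|))) :
    IntegrableOn (fun x => deriv (fun τ => ψ₁ τ x + ψ₂ τ x) t ^ 2
      + deriv (fun y => ψ₁ t y + ψ₂ t y) x ^ 2 + W x * (ψ₁ t x + ψ₂ t x) ^ 2) (Ioi (1 + |t|)) ∧
    Real.sqrt (∫ x in Ioi (1 + |t|), (deriv (fun τ => ψ₁ τ x + ψ₂ τ x) t ^ 2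
      + deriv (fun y => ψ₁ t y + ψ₂ t y) x ^ 2 + W x * (ψ₁ t x + ψ₂ t x) ^ 2))
      ≤ Real.sqrt (∫ x in Ioi (1 + |t|), (deriv (fun τ => ψ₁ τ x) t ^ 2 + deriv (ψ₁ t) x ^ 2
          + W x * ψ₁ t x ^ 2))
        + Real.sqrt (∫ x in Ioi (1 + |t|), (deriv (fun τ => ψ₂ τ x) t ^ 2 + deriv (ψ₂ t) x ^ 2
          + W x * ψ₂ t x ^ 2)) := by
  obtain ⟨hg₁c, -, i₁, i₂, i₃⟩ := farEnergy_pieces hW hW0 hψ₁ t hi₁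
  obtain ⟨hg₂c, -, j₁, j₂, j₃⟩ := farEnergy_pieces hW hW0 hψ₂ t hi₂
  have hh₁ : ContDiff ℝ 1 (ψ₁ t) := (hψ₁.comp (contDiff_const.prodMk contDiff_id)).of_le (by norm_num)
  have hh₂ : ContDiff ℝ 1 (ψ₂ t) := (hψ₂.comp (contDiff_const.prodMk contDiff_id)).of_le (by norm_num)
  have hmain := sqrt_energy_add_le hW hW0 hh₁ hh₂ hg₁c hg₂c measurableSet_Ioi i₁ i₂ i₃ j₁ j₂ j₃
  -- identify the time derivative of the sum
  have hdt : ∀ x, deriv (fun τ => ψ₁ τ x + ψ₂ τ x) t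
      = deriv (fun τ => ψ₁ τ x) t + deriv (fun τ => ψ₂ τ x) t := fun x =>
    deriv_fun_add (((hψ₁.comp (contDiff_id.prodMk contDiff_const)).differentiable (by norm_num)) t)
      (((hψ₂.comp (contDiff_id.prodMk contDiff_const)).differentiable (by norm_num)) t)
  have hfun : (fun x => deriv (fun τ => ψ₁ τ x + ψ₂ τ x) t ^ 2
      + deriv (fun y => ψ₁ t y + ψ₂ t y) x ^ 2 + W x * (ψ₁ t x + ψ₂ t x) ^ 2)
      = fun x => deriv (fun y => ψ₁ t y + ψ₂ t y) x ^ 2 + W x * (ψ₁ t x + ψ₂ t x) ^ 2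
        + (deriv (fun τ => ψ₁ τ x) t + deriv (fun τ => ψ₂ τ x) t) ^ 2 := by
    funext x; rw [hdt x]; ring
  have hA : (fun x => deriv (fun τ => ψ₁ τ x) t ^ 2 + deriv (ψ₁ t) x ^ 2 + W x * ψ₁ t x ^ 2)
      = fun x => deriv (ψ₁ t) x ^ 2 + W x * ψ₁ t x ^ 2 + deriv (fun τ => ψ₁ τ x) t ^ 2 := by
    funext x; ring
  have hB : (fun x => deriv (fun τ => ψ₂ τ x) t ^ 2 + deriv (ψ₂ t) x ^ 2 + W x * ψ₂ t x ^ 2)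
      = fun x => deriv (ψ₂ t) x ^ 2 + W x * ψ₂ t x ^ 2 + deriv (fun τ => ψ₂ τ x) t ^ 2 := by
    funext x; ring
  rw [hfun, hA, hB]
  exact hmain

/-- **Subtracting a non-radiating far solution does not increase the channel limits.** If the far
energies of `ψ₁, ψ₂` converge along a filter `l` to `L₁, L₂` with `L₂ = 0`, then the far energy
of `ψ₁ + ψ₂` — which converges, say to `L` — has `L ≤ L₁`. [folklore] -/
theorem farLimit_add_nonradiating_le (hW : Continuous W) (hW0 : ∀ x, 0 ≤ W x)
    (hψ₁ : ContDiff ℝ 2 (Function.uncurry ψ₁)) (hψ₂ : ContDiff ℝ 2 (Function.uncurry ψ₂))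
    (hi₁ : ∀ t, IntegrableOn (fun x => deriv (fun τ => ψ₁ τ x) t ^ 2 + deriv (ψ₁ t) x ^ 2
      + W x * ψ₁ t x ^ 2) (Ioi (1 + |t|)))
    (hi₂ : ∀ t, IntegrableOn (fun x => deriv (fun τ => ψ₂ τ x) t ^ 2 + deriv (ψ₂ t) x ^ 2
      + W x * ψ₂ t x ^ 2) (Ioi (1 + |t|))) {l : Filter ℝ} [l.NeBot] {L₁ L : ℝ}
    (h₁ : Tendsto (fun t => ∫ x in Ioi (1 + |t|), (deriv (fun τ => ψ₁ τ x) t ^ 2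
      + deriv (ψ₁ t) x ^ 2 + W x * ψ₁ t x ^ 2)) l (𝓝 L₁))
    (h₂ : Tendsto (fun t => ∫ x in Ioi (1 + |t|), (deriv (fun τ => ψ₂ τ x) t ^ 2
      + deriv (ψ₂ t) x ^ 2 + W x * ψ₂ t x ^ 2)) l (𝓝 0))
    (h : Tendsto (fun t => ∫ x in Ioi (1 + |t|), (deriv (fun τ => ψ₁ τ x + ψ₂ τ x) t ^ 2
      + deriv (fun y => ψ₁ t y + ψ₂ t y) x ^ 2 + W x * (ψ₁ t x + ψ₂ t x) ^ 2)) l (𝓝 L)) :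
    L ≤ L₁ := by
  have hL₁ : 0 ≤ L₁ :=
    ge_of_tendsto' h₁ fun t => setIntegral_nonneg measurableSet_Ioi fun x _ =>
      wave1D_energyDensity_nonneg hW0 t x
  have hL : 0 ≤ L :=
    ge_of_tendsto' h fun t => setIntegral_nonneg measurableSet_Ioi fun x _ =>
      wave1D_energyDensity_nonneg (ψ := fun t x => ψ₁ t x + ψ₂ t x) hW0 t x
  -- `√E ≤ √E₁ + √E₂` at every time, then pass to the limit
  have hsq : Real.sqrt L ≤ Real.sqrt L₁ + Real.sqrt 0 :=
    le_of_tendsto_of_tendsto' h.sqrt (h₁.sqrt.add h₂.sqrt) fun t =>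
      (sqrt_farEnergy_add_le hW hW0 hψ₁ hψ₂ t (hi₁ t) (hi₂ t)).2
  rw [Real.sqrt_zero, add_zero, Real.sqrt_le_sqrt_iff hL₁] at hsq
  exact hsq

end Literature.Analysis.PDE
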